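import Literature.MathematicalPhysics.QuantumFieldTheory.Balaban1983to89.B5Eq147Landau

/-!
# `Balaban1983to89.B5Eq165DeltaK` — T. Bałaban, *Propagators and renormalization transformations for lattice gauge
# theories. I*, Commun. Math. Phys. **95** (1984) 17–40 [Balaban1984PropagatorsI], Sect. D pp. 26–29: the operators `H_k`
# and **(1.64)/(1.65) PROVED FOR THE `Δ_k` OF (1.19)** (`B5Eq114Gauss.DeltaK`) on the typed tower of `B5SectBStatements`:
# `⟨B, Δ_kB⟩ = ⟨∂H_kB, ∂H_kB⟩ = 2·min{S^η(A) : Q_kA = B}`, with `H_kB` the minimiser in the Landau gauge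

statement-level skeleton of published theorems with citation tags; proofs where landed; nothing here is a claim about the Yang–Mills mass gap

PDF held: `paper:balaban1984-cmp95-propagators-rt-i` (journal page = PDF page + 16); pages read AS IMAGES by this seat:
renders `run/shared/lean/pub/pub-balaban/b2b-balaban-ref1/pages/1984-cmp95-propagators-rt-I/…-p010-x2.png` (p. 26: Sect. D,
(1.47)–(1.49)) and `…-p013-x2.png` (p. 29: (1.64)–(1.65)), besides the pages listed in `B5Eq147Landau`.

CITATION HEADER (lean-in-tree rule).  Cell `lit-balaban` (HOME `run/shared/lean/pub/lit-balaban/`), unit `lit-balaban-p16`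
gen 2 (Phase-2 proof seat p16; `literature-prover-lit-balaban-p16-g2-0`); WHAT IS REPRODUCED = SKELETON rows **B5.Eq1.64**
and **B5.Eq1.66** (member (1.65)) FOR THE (1.17) INTEGRAL / THE `Δ_k` OF (1.19) — owner r02's cells: B5.Eq1.64 «proved-torus
(for the typed (1.47) integral; (1.17) = (1.47) not typed)», B5.Eq1.15 honest scope «identity (1.14)/(1.65) ↔ (1.66) not
certified in the tree», interface row IF2-25 / question Q-IF2-7 («no kernel statement joining (1.19) to (1.64)/(1.65) for the
(1.17) integral») — THIS FILE proves, for r02's explicit `B5Eq114Gauss.DeltaK k = W_k†W_k`, the printed definition (1.65) by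
the Landau-gauge minimiser and the identity (1.64), on the tower carrier; the companion one-stroke side (p21 gen 3,
`B5TowerOneStroke`: transport to `B5Hk163Torus.HkOp`/`Beta.BlockEffectiveAction.DelK`) meets it at `isLeast_actionEta_fibre`
by `IsLeast.unique`.  Kind «discharge of printed identities for typed objects»: no `Prop` fact is introduced.

WHAT IS PRINTED (verbatim).
* p. 26 [PDF 10]: «We have to calculate the integral ((ST)^k e^{−S})(B) = z′^{(k)}∣det(Δ↾_{N(Q′_k)})∣∫dA δ(B − Q_kA)
  δ_R(∂*A) exp(−½⟨∂A, ∂A⟩). (1.47) With this integral an operator of fundamental importance is connected. It is defined on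
  configurations B on the lattice T₁^{(k)} and its value on such a configuration is equal to a configuration A on T_η
  minimizing the form ½⟨∂A, ∂A⟩ under the conditions Q_kA = B, R∂*A = 0.»
* p. 29 [PDF 13]: «Using (1.60), or better (1.63), we can verify all the properties of H_kB: Q_kH_kB = B, R∂*H_kB = 0, H_kB is
  a minimum of ½⟨∂A, ∂A⟩ on the hyperplane {A : Q_kA = B, R∂*A = 0}, which means that ⟨∂A′, ∂H_kB⟩ = 0 on the subspace
  {A′ : Q_kA′ = 0, R∂*A′ = 0}. Let us now come back to the integral (1.47). We make the translation A = A′ + H_kB and using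
  the above properties of H_kB, we get ((ST)^k e^{−S})(B) = Z_k exp(−½⟨∂H_kB, ∂H_kB⟩). (1.64) The action Δ_k is thus
  defined by ⟨B, Δ_kB⟩ = ⟨∂H_kB, ∂H_kB⟩. (1.65)»
* p. 20 [PDF 4]: «We define ((ST)^k e^{−S})(B) = Z_{k,Ax} exp(−½⟨B, Δ_kB⟩). (1.19)» (typed `B5SectBStatements.Eq119`, proved
  `B5Eq114Gauss.eq119_holds` with the explicit `DeltaK`), and p. 21 (1.21) «⟨∂A, ∂A⟩ = ½Σ_{x∈T_η,μ,ν} η^d∣F_{μν}(x)∣²» (so that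
  «½⟨∂A, ∂A⟩» = `S^η(A)` = `B5SectBStatements.actionEta`).

WHAT THIS FILE PROVES (kernel-checked, 0 sorry, axioms ⊆ {propext, Classical.choice, Quot.sound}).
§1 `S^η(A) = ½‖σ^k𝒯A‖²` (`actionEta_eq_half_norm_sq`, r02's `Tk`); pure gauges are flat (`Tk_Dg`); `S^η` is constant on
   residual orbits (`actionEta_add_orbit`).
§2 **THE VARIATIONAL MEANING OF r02's `Δ_k = W_k†W_k`**: `½⟨B, Δ_kB⟩ = ½‖(1 − R_k)σ^k𝒯 sec_kB‖²` is the squared distance of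
   `σ^k𝒯 sec_kB` from `σ^k𝒯(N(Q_k) ∩ Ax)`, hence **`½⟨B, Δ_kB⟩ = min{S^η(A) : Q_kA = B, A axial}` (attained:
   `exists_axialMin`) `= min{S^η(A) : Q_kA = B}` (every field is gauge-equivalent, within `N(Q′_k)`, to an axial one:
   `B5HierGaugeTorus.hierGauge_exists`; `isLeast_actionEta_fibre`) `= min{S^η(A) : Q_kA = B, R∂*A = 0}`
   (`isLeast_actionEta_landau`)**.
§3 **`H_k`** — «a configuration A on T_η minimizing the form ½⟨∂A, ∂A⟩ under the conditions Q_kA = B, R∂*A = 0»: the set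
   `landauMin k B` of such minimisers is NON-EMPTY (`landauMin_nonempty`) and, for `d ≥ 2`, a SINGLETON
   (`landauMin_subsingleton`: strict convexity — parallelogram law — plus «the above properties»: a flat field in
   `N(Q_k) ∩ {R∂*A = 0}` vanishes, `eq_zero_of_flat_landau`, from r02's `tower_pos` transported along the residual gauge
   orbit); «which means that ⟨∂A′, ∂H_kB⟩ = 0 on the subspace {A′ : Q_kA′ = 0, R∂*A′ = 0}» (`inner_Tk_eq_zero_of_mem_landauMin`).
§4 **(1.65) `⟨B, Δ_kB⟩ = ⟨∂H_kB, ∂H_kB⟩`** for `B5Eq114Gauss.DeltaK` and every Landau minimiser (`eq165`: `⟨B, Δ_kB⟩ =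
   2·S^η(H_kB)`), and **(1.64) `((ST)^k e^{−S})(B) = Z_k exp(−½⟨∂H_kB, ∂H_kB⟩)`**, `Z_k > 0` (`eq164`, d ≥ 2, from
   `B5Eq114Gauss.eq117_holds`/`rt17_gauss`).

HONEST SCOPE / READINGS.  (i) `H_kB` is characterised by its PRINTED defining property (the minimiser on the hyperplane
`{Q_kA = B, R∂*A = 0}`), as the member(s) of `landauMin k B`; no third closed form is introduced on the tower — the closed
forms (1.59)/(1.60)/(1.63) are the tree's `B5Hk160Torus`/`B5Hk163Torus.HkOp` on the one-stroke complex carrier, whose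
transport to the tower is p21's `B5TowerOneStroke` (it lands in `landauMin` by `B5Hk163RDiv.HkOp_minimum`).  (ii) «⟨∂H_kB,
∂H_kB⟩» is read through (1.21) as `2·S^η(H_kB)` (= `‖σ^k𝒯H_kB‖²`, `Tk`); the momentum form (1.66) is the tree's
`B5Bounds167Lattice.formDk`/`B5Hk163Form166` and is joined to this file's identity by p21's `isLeast_actionEta_DelK` and
`IsLeast.unique`, not here.  (iii) `2 ≤ d` enters uniqueness of `H_kB` and (1.64) (through `tower_pos`/`eq117_holds`); (1.65)
and the variational identities hold for every `d`, `L ≥ 1`, torus `M`, `k`; U = 1.  Value = kernel certificate that the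
Gaussian covariance `Δ_k` DEFINED by (1.19) is the Landau-gauge minimum (1.65) on one carrier; NOT summit progress.
-/

open scoped BigOperators InnerProductSpace
open MeasureTheory

namespace Literature.MathematicalPhysics.QuantumFieldTheory.Balaban1983to89.B5Eq165DeltaK

open B5SectBStatements B5Eq114Gauss B5HierGaugeTorus B5Eq147Landau
open B5Prop11Plancherel (Tor fine)

noncomputable section

variable {d : ℕ} (L : ℕ) (M : Fin d → ℕ) [NeZero L] [hM : ∀ μ, NeZero (M μ)]

/-! ## §1  `S^η(A) = ½‖σ^k𝒯A‖²`; pure gauges are flat; `S^η` is constant on the residual orbits -/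

/-- **«½⟨∂A, ∂A⟩» = `S^η(A) = ½‖σ^k𝒯A‖²`** on level `k` (r02's dilated curvature map `Tk = σ^k𝒯`; (1.5) + (1.21)).
[cite: Balaban1984PropagatorsI, (1.21) p.21, (1.5) p.18] -/
theorem actionEta_eq_half_norm_sq (k : ℕ) (A : Fld (towerM L M k)) :
    actionEta L M k A = 1 / 2 * ‖Tk L M k A‖ ^ 2 := by
  rw [← action1_sigma_pow_smul, action1_eq_half_norm_sq, Tk, LinearMap.smul_apply, map_smul]

/-- `S^η ≥ 0`. [cite: Balaban1984PropagatorsI, (1.21) p.21] -/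
theorem actionEta_nonneg (k : ℕ) (A : Fld (towerM L M k)) : 0 ≤ actionEta L M k A := by
  rw [actionEta_eq_half_norm_sq]; positivity

/-- `S^η(A + ∂λ) = S^η(A)` for `λ ∈ N(Q′_k)` («all the expressions in the integral (1.17) with the exception of gauge fixing
terms δ_Ax are invariant», p. 21). [cite: Balaban1984PropagatorsI, (1.22) p.21] -/
theorem actionEta_add_orbit (k : ℕ) (A g : Fld (towerM L M k)) (hg : g ∈ orbit L M k) :
    actionEta L M k (A + g) = actionEta L M k A := by
  obtain ⟨l, -, rfl⟩ := (mem_orbit_iff L M k g).1 hg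
  rw [add_Dg_eq_gaugeR, actionEta_gaugeR]

/-- **pure gauges are flat**: `σ^k𝒯(∂λ) = 0` («The covariant derivative ∂A, and so the action above, are invariant with
respect to gauge transformations», p. 18). [cite: Balaban1984PropagatorsI, (1.4) p.18] -/
theorem Tk_Dg (k : ℕ) (l : Scl (towerM L M k)) : Tk L M k (Dg L M k l) = 0 := by
  have h1 : actionEta L M k (Dg L M k l) = actionEta L M k 0 := by
    rw [← zero_add (Dg L M k l), add_Dg_eq_gaugeR, actionEta_gaugeR]
  have h0 : actionEta L M k (0 : Fld (towerM L M k)) = 0 := by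
    rw [actionEta_eq_half_norm_sq, map_zero, norm_zero]; ring
  rw [h0, actionEta_eq_half_norm_sq] at h1
  have h2 : ‖Tk L M k (Dg L M k l)‖ ^ 2 = 0 := by linarith
  exact norm_eq_zero.1 (pow_eq_zero_iff two_ne_zero |>.1 h2)

/-- `σ^k𝒯` vanishes on the residual orbit directions. [cite: Balaban1984PropagatorsI, (1.4) p.18] -/
theorem Tk_eq_zero_of_mem_orbit (k : ℕ) {g : Fld (towerM L M k)} (hg : g ∈ orbit L M k) : Tk L M k g = 0 := by
  obtain ⟨l, -, rfl⟩ := (mem_orbit_iff L M k g).1 hg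
  exact Tk_Dg L M k l

/-! ## §2  The variational meaning of `Δ_k = W_k†W_k`: `½⟨B, Δ_kB⟩ = min{S^η(A) : Q_kA = B}` -/

section Generic

variable {E' : Type*} [NormedAddCommGroup E'] [InnerProductSpace ℝ E'] [FiniteDimensional ℝ E']

omit [NeZero L] hM in
/-- the orthogonal projection minimises the distance (Pythagoras): `‖f − Pf‖ ≤ ‖f − w‖` for `w ∈ K`.
[cite: Balaban1984PropagatorsI, p.26 «minimizing the form ½⟨∂A, ∂A⟩ under the conditions Q_kA = B, R∂*A = 0»] -/
theorem norm_sub_starProjection_le (K : Submodule ℝ E') (f w : E') (hw : w ∈ K) :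
    ‖f - K.starProjection f‖ ≤ ‖f - w‖ := by
  have hsum : f - w = (f - K.starProjection f) + (K.starProjection f - w) := by abel
  have horth : ⟪f - K.starProjection f, K.starProjection f - w⟫_ℝ = 0 :=
    Submodule.inner_left_of_mem_orthogonal (K.sub_mem (Submodule.starProjection_apply_mem K f) hw)
      (Submodule.sub_starProjection_mem_orthogonal f)
  have hpy := norm_add_sq_eq_norm_sq_add_norm_sq_real horth
  rw [← hsum] at hpy
  have h1 : 0 ≤ ‖K.starProjection f - w‖ * ‖K.starProjection f - w‖ := mul_self_nonneg _
  exact (mul_self_le_mul_self_iff (norm_nonneg _) (norm_nonneg _)).2 (by linarith)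

end Generic

/-- `W_kB = σ^k𝒯(sec_kB) − R_k σ^k𝒯(sec_kB)` (r02's definition, unfolded). [cite: Balaban1984PropagatorsI, (1.19) p.20] -/
theorem Wk_apply (k : ℕ) (B : Fld M) :
    Wk L M k B = Tk L M k (secK L M k B)
      - Rim (Tk L M k) (dirSpace (Qk L M k) (AxAll L M k)) (Tk L M k (secK L M k B)) := rfl

/-- `½⟨B, Δ_kB⟩ = ½‖W_kB‖²`. [cite: Balaban1984PropagatorsI, (1.19) p.20] -/
theorem S1_DeltaK_eq (k : ℕ) (B : Fld M) : S1 M (DeltaK L M k) B = 1 / 2 * ‖Wk L M k B‖ ^ 2 := by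
  rw [S1, inner_DeltaK]

/-- **THE AXIAL MINIMISER**: there is `A_* ∈ {Q_kA = B, A, QA, … axial}` with `S^η(A_*) = ½⟨B, Δ_kB⟩` and `S^η(A_*) ≤ S^η(A)`
for every such `A` — `½⟨B, Δ_kB⟩` is the distance² of `σ^k𝒯 sec_kB` from `σ^k𝒯(N(Q_k) ∩ Ax)`, attained at a preimage of
the projection. [cite: Balaban1984PropagatorsI, (1.19) p.20, p.26 (text)] -/
theorem exists_axialMin (k : ℕ) (B : Fld M) :
    ∃ A ∈ fibre (Qk L M k) (AxAll L M k) B, actionEta L M k A = S1 M (DeltaK L M k) B ∧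
      ∀ A' ∈ fibre (Qk L M k) (AxAll L M k) B, actionEta L M k A ≤ actionEta L M k A' := by
  set N := dirSpace (Qk L M k) (AxAll L M k) with hN
  set T := Tk L M k with hT
  set f := T (secK L M k B) with hf
  obtain ⟨v₀, hv₀, hTv₀⟩ := exists_preimage_Rim T N f
  refine ⟨secK L M k B - v₀, ?_, ?_, ?_⟩
  · rw [sub_eq_add_neg]
    exact (add_mem_fibre_iff (secK_mem_fibre L M k B) _).2 (N.neg_mem hv₀)
  · rw [S1_DeltaK_eq, actionEta_eq_half_norm_sq, Wk_apply, map_sub, ← hT, ← hf, hTv₀]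
  · intro A' hA'
    have hv : A' - secK L M k B ∈ N := sub_mem_dirSpace (secK_mem_fibre L M k B) hA'
    have hw : -(T (A' - secK L M k B)) ∈ imSub T N := (imSub T N).neg_mem (Submodule.mem_map_of_mem hv)
    have hle := norm_sub_starProjection_le (imSub T N) f _ hw
    have h1 : f - (imSub T N).starProjection f = T (secK L M k B - v₀) := by
      rw [map_sub, ← hf, hTv₀]; rfl
    have h2 : f - -(T (A' - secK L M k B)) = T A' := by rw [hf, map_sub]; abel
    rw [h1, h2] at hle
    rw [actionEta_eq_half_norm_sq, actionEta_eq_half_norm_sq, ← hT]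
    have := mul_self_le_mul_self (norm_nonneg _) hle
    nlinarith

/-- **`½⟨B, Δ_kB⟩ ≤ S^η(A)` for EVERY `A` with `Q_kA = B`**: every field is gauge-equivalent within `N(Q′_k)` to an axial one
(hierarchical gauge), and `S^η`, `Q_k` are invariant. [cite: Balaban1984PropagatorsI, (1.19) p.20, (1.23) p.21] -/
theorem S1_DeltaK_le_actionEta (k : ℕ) {B : Fld M} {A : Fld (towerM L M k)} (hA : Qk L M k A = B) :
    S1 M (DeltaK L M k) B ≤ actionEta L M k A := by
  obtain ⟨A₀, -, hval, hmin⟩ := exists_axialMin L M k B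
  obtain ⟨l, hl, hAx⟩ := hierGauge_exists L M k A
  have hfib : gaugeR L M k A l ∈ fibre (Qk L M k) (AxAll L M k) B := by
    refine ⟨?_, hAx⟩
    rw [gaugeR_eq_sub_Dg, map_sub, hA, Qk_Dg_eq_zero L M k hl, sub_zero]
  rw [← hval, ← actionEta_gaugeR L M k A l]
  exact hmin _ hfib

/-- **`½⟨B, Δ_kB⟩ = min{S^η(A) : Q_kA = B}`** (least value, attained) — the variational meaning of the Gaussian covariance of
(1.19); this is the tower side of the interface identity IF2-25 (the one-stroke side `B5TowerOneStroke.isLeast_actionEta`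
has the same left member, so `IsLeast.unique` joins them). [cite: Balaban1984PropagatorsI, (1.19) p.20, (1.65) p.29] -/
theorem isLeast_actionEta_fibre (k : ℕ) (B : Fld M) :
    IsLeast ((actionEta L M k) '' {A | Qk L M k A = B}) (S1 M (DeltaK L M k) B) := by
  obtain ⟨A₀, hA₀, hval, -⟩ := exists_axialMin L M k B
  refine ⟨⟨A₀, hA₀.1, hval⟩, ?_⟩
  rintro x ⟨A, hA, rfl⟩
  exact S1_DeltaK_le_actionEta L M k hA

/-- the same over the typed fibre `fibre (Qk k) ⊤ B` of `B5SectBStatements.rt23`. [cite: Balaban1984PropagatorsI, (1.19) p.20] -/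
theorem isLeast_actionEta_fibre_top (k : ℕ) (B : Fld M) :
    IsLeast ((actionEta L M k) '' fibre (Qk L M k) ⊤ B) (S1 M (DeltaK L M k) B) := by
  have hset : fibre (Qk L M k) ⊤ B = {A | Qk L M k A = B} := by
    ext A; simp [mem_fibre_iff]
  rw [hset]
  exact isLeast_actionEta_fibre L M k B

/-- `½⟨B, Δ_kB⟩ = min{S^η(A) : Q_kA = B, A, …, Q_{k−1}A axial}`. [cite: Balaban1984PropagatorsI, (1.19) p.20] -/
theorem isLeast_actionEta_axial (k : ℕ) (B : Fld M) :
    IsLeast ((actionEta L M k) '' fibre (Qk L M k) (AxAll L M k) B) (S1 M (DeltaK L M k) B) := by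
  obtain ⟨A₀, hA₀, hval, -⟩ := exists_axialMin L M k B
  refine ⟨⟨A₀, hA₀, hval⟩, ?_⟩
  rintro x ⟨A, hA, rfl⟩
  exact S1_DeltaK_le_actionEta L M k hA.1

/-- **`½⟨B, Δ_kB⟩ = min{S^η(A) : Q_kA = B, R∂*A = 0}`** — the minimum «under the conditions Q_kA = B, R∂*A = 0» of p. 26 is the
Gaussian exponent of (1.19) (attained: the Landau representative of the axial minimiser).
[cite: Balaban1984PropagatorsI, p.26 (text), (1.65) p.29] -/
theorem isLeast_actionEta_landau (k : ℕ) (B : Fld M) :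
    IsLeast ((actionEta L M k) '' fibre (Qk L M k) (Lan L M k) B) (S1 M (DeltaK L M k) B) := by
  obtain ⟨A₀, hA₀, hval, -⟩ := exists_axialMin L M k B
  -- Landau representative of `A₀`
  have htop : A₀ ∈ Lan L M k ⊔ orbit L M k := by
    rw [(isCompl_Lan_orbit L M k).sup_eq_top]; exact Submodule.mem_top
  obtain ⟨AL, hAL, g, hg, hsum⟩ := Submodule.mem_sup.1 htop
  have hALeq : AL = A₀ + -g := by rw [← hsum]; abel
  refine ⟨⟨AL, ⟨?_, hAL⟩, ?_⟩, ?_⟩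
  · rw [hALeq, map_add, map_neg, hA₀.1, LinearMap.mem_ker.1 (orbit_le_ker L M k hg), neg_zero, add_zero]
  · rw [hALeq, actionEta_add_orbit L M k A₀ (-g) ((orbit L M k).neg_mem hg), hval]
  · rintro x ⟨A, hA, rfl⟩
    exact S1_DeltaK_le_actionEta L M k hA.1

/-! ## §3  `H_k`: the minimiser in the Landau gauge exists and is unique -/

/-- **`H_kB`, by its printed definition**: «a configuration A on T_η minimizing the form ½⟨∂A, ∂A⟩ under the conditions
Q_kA = B, R∂*A = 0» — the SET of such minimisers on level `k` of the tower (a singleton for `d ≥ 2`, `landauMin_subsingleton`;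
its member is the tree's `B5Hk163Torus.HkOp` transported, p21's `B5TowerOneStroke`). [cite: Balaban1984PropagatorsI, p.26 (text), (1.49) p.26] -/
def landauMin (k : ℕ) (B : Fld M) : Set (Fld (towerM L M k)) :=
  {A | A ∈ fibre (Qk L M k) (Lan L M k) B ∧ ∀ A' ∈ fibre (Qk L M k) (Lan L M k) B, actionEta L M k A ≤ actionEta L M k A'}

/-- membership unfolding. [cite: Balaban1984PropagatorsI, p.26 (text)] -/
theorem mem_landauMin_iff (k : ℕ) (B : Fld M) (A : Fld (towerM L M k)) :
    A ∈ landauMin L M k B ↔ A ∈ fibre (Qk L M k) (Lan L M k) B ∧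
      ∀ A' ∈ fibre (Qk L M k) (Lan L M k) B, actionEta L M k A ≤ actionEta L M k A' := Iff.rfl

/-- **existence of `H_kB`** for every `B` (every `d`, `L`, torus, `k`). [cite: Balaban1984PropagatorsI, p.26 (text)] -/
theorem landauMin_nonempty (k : ℕ) (B : Fld M) : (landauMin L M k B).Nonempty := by
  obtain ⟨⟨A, hA, hval⟩, hle⟩ := isLeast_actionEta_landau L M k B
  exact ⟨A, hA, fun A' hA' => by rw [hval]; exact hle ⟨A', hA', rfl⟩⟩

/-- «Q_kH_kB = B, R∂*H_kB = 0». [cite: Balaban1984PropagatorsI, p.29 (text)] -/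
theorem mem_fibre_of_mem_landauMin (k : ℕ) {B : Fld M} {A : Fld (towerM L M k)} (hA : A ∈ landauMin L M k B) :
    Qk L M k A = B ∧ Rproj L M k (Dv L M k A) = 0 :=
  ⟨hA.1.1, (mem_Lan_iff L M k A).1 hA.1.2⟩

/-- the value at a Landau minimiser is the Gaussian exponent: `S^η(H_kB) = ½⟨B, Δ_kB⟩`.
[cite: Balaban1984PropagatorsI, (1.64)–(1.65) p.29] -/
theorem actionEta_of_mem_landauMin (k : ℕ) {B : Fld M} {A : Fld (towerM L M k)} (hA : A ∈ landauMin L M k B) :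
    actionEta L M k A = S1 M (DeltaK L M k) B := by
  obtain ⟨⟨A₁, hA₁, hval⟩, hle⟩ := isLeast_actionEta_landau L M k B
  refine le_antisymm ?_ (hle ⟨A, hA.1, rfl⟩)
  rw [← hval]
  exact hA.2 A₁ hA₁

/-- **a flat field in `N(Q_k) ∩ {R∂*A = 0}` vanishes** (d ≥ 2): gauge it into the hierarchical axial gauge (`hierGauge_exists`),
where r02's `tower_pos` applies, so it is a pure gauge `∂λ`, `λ ∈ N(Q′_k)` — and `Lan ∩ ∂N(Q′_k) = 0`.  This is the
non-degeneracy that makes «δ_R(∂*A)» remove exactly the flat directions of `½⟨∂A, ∂A⟩` on `{Q_kA = B}`.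
[cite: Balaban1984PropagatorsI, p.26 (text), p.25 «Δ is positive definite on N(Q′_k)»] -/
theorem eq_zero_of_flat_landau (hd : 2 ≤ d) (k : ℕ) {v : Fld (towerM L M k)}
    (hv : v ∈ dirSpace (Qk L M k) (Lan L M k)) (hflat : Tk L M k v = 0) : v = 0 := by
  obtain ⟨hvQ, hvL⟩ := (mem_dirSpace_iff v).1 hv
  obtain ⟨l, hl, hAx⟩ := hierGauge_exists L M k v
  set w := gaugeR L M k v l with hw
  have hwQ : Qk L M k w = 0 := by
    rw [hw, gaugeR_eq_sub_Dg, map_sub, hvQ, Qk_Dg_eq_zero L M k hl, sub_zero]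
  have hwT : Tk L M k w = 0 := by
    rw [hw, gaugeR_eq_sub_Dg, map_sub, hflat, Tk_Dg, sub_zero]
  have hwflat : action1 w = 0 := by
    rw [action1_eq_zero_iff]
    rw [Tk, LinearMap.smul_apply, smul_eq_zero] at hwT
    exact hwT.resolve_left (pow_ne_zero k (sigmaL_pos (d := d) L).ne')
  have hw0 : w = 0 := tower_pos L M hd k w ((mem_dirSpace_iff w).2 ⟨hwQ, hAx⟩) hwflat
  have hvO : v ∈ orbit L M k := by
    have : v = Dg L M k l := by
      rw [hw, gaugeR_eq_sub_Dg, sub_eq_zero] at hw0; exact hw0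
    rw [this]; exact (mem_orbit_iff L M k _).2 ⟨l, hl, rfl⟩
  have := (isCompl_Lan_orbit L M k).inf_eq_bot
  rw [Submodule.eq_bot_iff] at this
  exact this v (Submodule.mem_inf.2 ⟨hvL, hvO⟩)

/-- **uniqueness of `H_kB`** (d ≥ 2): two minimisers on the hyperplane `{Q_kA = B, R∂*A = 0}` coincide (strict convexity of
`½⟨∂A, ∂A⟩` transversally to the residual orbit: parallelogram law + `eq_zero_of_flat_landau`).
[cite: Balaban1984PropagatorsI, p.26 (text), p.29 (text)] -/
theorem landauMin_subsingleton (hd : 2 ≤ d) (k : ℕ) (B : Fld M) : (landauMin L M k B).Subsingleton := by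
  intro A₁ h₁ A₂ h₂
  set T := Tk L M k with hT
  have hm₁ := actionEta_of_mem_landauMin L M k h₁
  have hm₂ := actionEta_of_mem_landauMin L M k h₂
  -- the midpoint lies on the hyperplane
  set Am : Fld (towerM L M k) := (1 / 2 : ℝ) • (A₁ + A₂) with hAm
  have hAm_fib : Am ∈ fibre (Qk L M k) (Lan L M k) B := by
    refine ⟨?_, (Lan L M k).smul_mem _ ((Lan L M k).add_mem h₁.1.2 h₂.1.2)⟩
    rw [hAm, map_smul, map_add, h₁.1.1, h₂.1.1, ← two_smul ℝ B, smul_smul]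
    norm_num
  have hle : actionEta L M k A₁ ≤ actionEta L M k Am := h₁.2 Am hAm_fib
  rw [actionEta_eq_half_norm_sq, actionEta_eq_half_norm_sq, ← hT] at hle
  rw [actionEta_eq_half_norm_sq, ← hT] at hm₁ hm₂
  have hTm : T Am = (1 / 2 : ℝ) • (T A₁ + T A₂) := by rw [hAm, map_smul, map_add]
  have hnorm : ‖T Am‖ = 1 / 2 * ‖T A₁ + T A₂‖ := by
    rw [hTm, norm_smul, Real.norm_eq_abs, abs_of_pos (by norm_num : (0 : ℝ) < 1 / 2)]
  have hpar := parallelogram_law_with_norm ℝ (T A₁) (T A₂)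
  have hsq : ‖T A₁ - T A₂‖ ^ 2 ≤ 0 := by
    rw [hnorm] at hle
    nlinarith [hpar, hm₁, hm₂, sq_nonneg ‖T A₁ + T A₂‖]
  have hflat : T (A₁ - A₂) = 0 := by
    rw [map_sub]
    exact norm_eq_zero.1 (pow_eq_zero_iff two_ne_zero |>.1 (le_antisymm hsq (sq_nonneg _)))
  have hdir : A₁ - A₂ ∈ dirSpace (Qk L M k) (Lan L M k) := sub_mem_dirSpace h₂.1 h₁.1
  exact sub_eq_zero.1 (eq_zero_of_flat_landau L M hd k hdir hflat)

/-- existence and uniqueness of `H_kB` together (d ≥ 2). [cite: Balaban1984PropagatorsI, p.26 (text)] -/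
theorem existsUnique_landauMin (hd : 2 ≤ d) (k : ℕ) (B : Fld M) : ∃! A, A ∈ landauMin L M k B := by
  obtain ⟨A, hA⟩ := landauMin_nonempty L M k B
  exact ⟨A, hA, fun A' hA' => landauMin_subsingleton L M hd k B hA' hA⟩

/-- **«which means that ⟨∂A′, ∂H_kB⟩ = 0 on the subspace {A′ : Q_kA′ = 0, R∂*A′ = 0}»** — the variational equation of the
constrained minimum, for `σ^k𝒯` (first variation along the hyperplane). [cite: Balaban1984PropagatorsI, p.29 (text)] -/
theorem inner_Tk_eq_zero_of_mem_landauMin (k : ℕ) {B : Fld M} {A : Fld (towerM L M k)} (hA : A ∈ landauMin L M k B)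
    {v : Fld (towerM L M k)} (hv : v ∈ dirSpace (Qk L M k) (Lan L M k)) : ⟪Tk L M k A, Tk L M k v⟫_ℝ = 0 := by
  set p := ⟪Tk L M k A, Tk L M k v⟫_ℝ with hp
  set q := ‖Tk L M k v‖ ^ 2 with hq
  -- minimality along the line `A + t v`
  have hline : ∀ t : ℝ, 0 ≤ 2 * t * p + t ^ 2 * q := by
    intro t
    have hmem : A + t • v ∈ fibre (Qk L M k) (Lan L M k) B :=
      (add_mem_fibre_iff hA.1 _).2 ((dirSpace (Qk L M k) (Lan L M k)).smul_mem t hv)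
    have hle := hA.2 _ hmem
    rw [actionEta_eq_half_norm_sq, actionEta_eq_half_norm_sq, map_add, map_smul, norm_add_sq_real,
      real_inner_smul_right, norm_smul, mul_pow, Real.norm_eq_abs, sq_abs] at hle
    nlinarith [hle]
  have hq0 : 0 ≤ q := by positivity
  have h := hline (-p / (q + 1))
  have hq1 : (0 : ℝ) < q + 1 := by linarith
  have hkey : 0 ≤ -(p ^ 2 * (q + 2)) / (q + 1) ^ 2 := by
    have : 2 * (-p / (q + 1)) * p + (-p / (q + 1)) ^ 2 * q = -(p ^ 2 * (q + 2)) / (q + 1) ^ 2 := by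
      field_simp
      ring
    rwa [this] at h
  have hnum : p ^ 2 * (q + 2) ≤ 0 := by
    have h2 : 0 < (q + 1) ^ 2 := by positivity
    have := mul_nonneg hkey h2.le
    rw [div_mul_cancel₀ _ h2.ne'] at this
    linarith
  have hp2 : p ^ 2 ≤ 0 := by nlinarith [sq_nonneg p]
  exact pow_eq_zero_iff two_ne_zero |>.1 (le_antisymm hp2 (sq_nonneg p))

/-! ## §4  (1.65) and (1.64) for the `Δ_k` of (1.19) -/

/-- **(1.65) PROVED for `B5Eq114Gauss.DeltaK`**: «The action Δ_k is thus defined by ⟨B, Δ_kB⟩ = ⟨∂H_kB, ∂H_kB⟩. (1.65)» — for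
every Landau minimiser `H_kB ∈ landauMin k B`, `⟨B, Δ_kB⟩ = 2·S^η(H_kB)` (= «⟨∂H_kB, ∂H_kB⟩» by (1.21)), every `d`.
[cite: Balaban1984PropagatorsI, (1.65) p.29] -/
theorem eq165 (k : ℕ) {B : Fld M} {A : Fld (towerM L M k)} (hA : A ∈ landauMin L M k B) :
    ⟪B, DeltaK L M k B⟫_ℝ = 2 * actionEta L M k A := by
  have h := actionEta_of_mem_landauMin L M k hA
  rw [S1] at h
  linarith

/-- (1.65) with the curvature norm: `⟨B, Δ_kB⟩ = ‖σ^k𝒯(H_kB)‖²`. [cite: Balaban1984PropagatorsI, (1.65) p.29, (1.21) p.21] -/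
theorem eq165_norm_sq (k : ℕ) {B : Fld M} {A : Fld (towerM L M k)} (hA : A ∈ landauMin L M k B) :
    ⟪B, DeltaK L M k B⟫_ℝ = ‖Tk L M k A‖ ^ 2 := by
  rw [eq165 L M k hA, actionEta_eq_half_norm_sq]; ring

/-- **(1.64) PROVED** (d ≥ 2): «((ST)^k e^{−S})(B) = Z_k exp(−½⟨∂H_kB, ∂H_kB⟩)», `Z_k > 0` — for the k-fold transformation
`B5SectBStatements.iterST` and every Landau minimiser, from (1.17) (`eq117_holds`), the Gaussian form of its right side
(`rt17_gauss`) and (1.65). [cite: Balaban1984PropagatorsI, (1.64) p.29] -/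
theorem eq164 (hd : 2 ≤ d) (k : ℕ) :
    ∃ Z : ℝ, 0 < Z ∧ ∀ (B : Fld M) (A : Fld (towerM L M k)), A ∈ landauMin L M k B →
      iterST L M k (fun A => Real.exp (-action1 A)) B = Z * Real.exp (-actionEta L M k A) := by
  obtain ⟨z, hz, h⟩ := eq117_holds L M hd k
  refine ⟨z * Zk L M k, mul_pos hz (Zk_pos L M hd k), fun B A hA => ?_⟩
  rw [h B, rt17_gauss, actionEta_of_mem_landauMin L M k hA, mul_assoc]

/-- (1.64) through (1.47): the Landau-gauge integral itself is `c·exp(−S^η(H_kB))` (d ≥ 2).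
[cite: Balaban1984PropagatorsI, (1.47) p.26, (1.64) p.29] -/
theorem rt47_eq_exp_landauMin (hd : 2 ≤ d) (k : ℕ) :
    ∃ c : ℝ, 0 < c ∧ ∀ (B : Fld M) (A : Fld (towerM L M k)), A ∈ landauMin L M k B →
      rt47 L M k B = c * Real.exp (-actionEta L M k A) := by
  obtain ⟨c, hc, h⟩ := rt47_gauss L M hd k
  exact ⟨c, hc, fun B A hA => by rw [h B, actionEta_of_mem_landauMin L M k hA]⟩

end

end Literature.MathematicalPhysics.QuantumFieldTheory.Balaban1983to89.B5Eq165DeltaK
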